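import Literature.NumberTheory.ComplexMultiplication.CMTypeRankCharacters
import HarnessLib

/-!
# The rank of the translates of a subset of a finite commutative group is the number of characters with
# non-vanishing sum over it (Kubota's mechanism, without the CM-type hypothesis)

T. Kubota, *On the field extension by complex multiplication*, Trans. AMS **118** (1965) [Kubota1965], §2 Lemma 1
("the dimension of `P(G)^Φ` … is equal to the rank") and §4 Lemma 2 (proof: expansion of the translates of a type in
the characters of the abelian Galois group, p. 119).  The tree's `CMTypeRankCharacters.lean` runs this argument for a
CM type `Φ` (keeping the intermediate count private) and states only the CM form
`IsCMTypeWith.typeRank_eq_one_add_ncard_oddCharacters`.  Dodson's constant weight criterion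
(`ConstantWeightCriterion.lean`) needs the count for an ARBITRARY subset `f ⊆ G₀` (the weight vector of a type, not
a CM type), so it is proved here in that generality:

* **`typeRank_eq_ncard_sum_ne_zero`** — for any finite subset `S` of a finite commutative group `H` acting on itself,
  `typeRank H S = #{ψ ∈ Ĥ : Σ_{s∈S} ψ(s) ≠ 0}`: the translates `x ↦ [gx ∈ S]` expand as `Σ_ψ ĉ(ψ)ψ(g)ψ(x)` with
  `ĉ(ψ) = |H|⁻¹ Σ_{s∈S} ψ̄(s)`, the span of the translates is the span of the characters with `ĉ(ψ) ≠ 0`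
  (orthogonality), the characters are linearly independent, and `ψ ↦ ψ̄` matches `ĉ(ψ) ≠ 0` with `Σ_S ψ ≠ 0`.

Theorem only; no definition, no named fact.

## References

* [Kubota1965] T. Kubota, Trans. AMS 118 (1965), §2 Lemma 1, §4 Lemma 2 (proof).
-/

set_option autoImplicit false

noncomputable section

open scoped BigOperators

namespace Literature.NumberTheory.ComplexMultiplication

/-! ### The rank of the translates of a subset, via characters -/

section FourierRank

variable {H : Type*} [CommGroup H] [Finite H]

/-- **Rank of the translates = number of non-vanishing Fourier coefficients.**  For ANY finite subset `S` of a finite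
commutative group `H` (acting on itself by translation), the Kubota–Dodson rank of `S` — the dimension of the span of
the indicator vectors of its translates — equals the number of characters `ψ` of `H` with `Σ_{s∈S} ψ(s) ≠ 0`: the
translates `x ↦ [gx ∈ S]` expand as `Σ_ψ ĉ(ψ)ψ(g)ψ(x)` with `ĉ(ψ) = |H|⁻¹ Σ_{s∈S} ψ̄(s)`, the characters are linearly
independent, and `ψ ↦ ψ̄` is a bijection. [cite: Kubota1965, §2 Lemma 1 and §4 Lemma 2 (proof)] -/
theorem typeRank_eq_ncard_sum_ne_zero (S : Finset H) :
    typeRank H (S : Set H) = {ψ : AddChar (Additive H) ℂ | ∑ s ∈ S, ψ (Additive.ofMul s) ≠ 0}.ncard := by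
  classical
  haveI : Fintype H := Fintype.ofFinite H
  -- characters as complex functions on `H`
  let cf : AddChar (Additive H) ℂ → H → ℂ := fun ψ x => ψ (Additive.ofMul x)
  have cf_mul : ∀ (ψ : AddChar (Additive H) ℂ) (x y : H), cf ψ (x * y) = cf ψ x * cf ψ y := fun ψ x y => by
    simp only [cf, ofMul_mul, AddChar.map_add_eq_mul]
  have hli : LinearIndependent ℂ cf := by
    have h := AddChar.linearIndependent (Additive H) ℂ
    -- `cf ψ = ψ ∘ ofMul`, and precomposition with the bijection `ofMul` preserves linear independence
    let L : (Additive H → ℂ) ≃ₗ[ℂ] (H → ℂ) := LinearEquiv.funCongrLeft ℂ ℂ Additive.toMul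
    have hcf : cf = L ∘ ((⇑) : AddChar (Additive H) ℂ → Additive H → ℂ) := by
      funext ψ x; rfl
    rw [hcf]
    exact h.map' L.toLinearMap L.ker
  have hcard : (Fintype.card H : ℂ) ≠ 0 := Nat.cast_ne_zero.2 Fintype.card_ne_zero
  -- dual orthogonality `Σ_ψ ψ(x) = |H| [x = 1]`
  have horth : ∀ x : H, ∑ ψ : AddChar (Additive H) ℂ, cf ψ x = if x = 1 then (Fintype.card H : ℂ) else 0 := by
    intro x
    have h := AddChar.sum_apply_eq_ite (α := Additive H) (Additive.ofMul x)
    have hc : Fintype.card (Additive H) = Fintype.card H := Fintype.card_congr Additive.toMul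
    simp only [cf]
    rw [h, hc]
    by_cases hx : x = 1
    · subst hx; simp
    · rw [if_neg hx, if_neg]
      exact fun h' => hx (Additive.ofMul.injective (by rw [h']; rfl))
  -- Fourier coefficients and the expansion of the translates
  let co : AddChar (Additive H) ℂ → ℂ := fun ψ => (Fintype.card H : ℂ)⁻¹ * ∑ s ∈ S, cf ψ s⁻¹
  let tr : H → H → ℂ := fun g x => (translateInd (S : Set H) g x : ℂ)
  have htr : ∀ g : H, tr g = ∑ ψ : AddChar (Additive H) ℂ, (co ψ * cf ψ g) • cf ψ := by
    intro g
    funext x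
    simp only [tr, co, Finset.sum_apply, Pi.smul_apply, smul_eq_mul]
    have h1 : ∀ ψ : AddChar (Additive H) ℂ, (Fintype.card H : ℂ)⁻¹ * (∑ s ∈ S, cf ψ s⁻¹) * cf ψ g * cf ψ x =
        (Fintype.card H : ℂ)⁻¹ * ∑ s ∈ S, cf ψ (g * x * s⁻¹) := by
      intro ψ
      rw [Finset.mul_sum, Finset.mul_sum, Finset.sum_mul, Finset.sum_mul]
      refine Finset.sum_congr rfl fun s _ => ?_
      rw [cf_mul, cf_mul]; ring
    simp_rw [h1]
    rw [← Finset.mul_sum, Finset.sum_comm]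
    simp_rw [horth]
    have h2 : ∑ s ∈ S, (if g * x * s⁻¹ = 1 then (Fintype.card H : ℂ) else 0) =
        if g * x ∈ S then (Fintype.card H : ℂ) else 0 := by
      have h3 : ∀ s : H, (g * x * s⁻¹ = 1) ↔ s = g * x := fun s => by rw [mul_inv_eq_one]; exact eq_comm
      simp_rw [h3]
      rw [Finset.sum_ite_eq' S (g * x)]
    rw [h2]
    by_cases hgx : g * x ∈ S
    · have : g • x ∈ (S : Set H) := by simpa using hgx
      rw [if_pos hgx, translateInd_of_mem this, inv_mul_cancel₀ hcard]; simp
    · have : g • x ∉ (S : Set H) := by simpa using hgx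
      rw [if_neg hgx, translateInd_of_not_mem this, mul_zero]; simp
  -- the span of the translates is the span of the characters with `co ≠ 0`
  set C : Set (AddChar (Additive H) ℂ) := {ψ | co ψ ≠ 0} with hC
  have hspan : Submodule.span ℂ (Set.range tr) = Submodule.span ℂ (cf '' C) := by
    refine le_antisymm (Submodule.span_le.2 ?_) (Submodule.span_le.2 ?_)
    · rintro _ ⟨g, rfl⟩
      rw [htr g]
      refine Submodule.sum_mem _ fun ψ _ => ?_
      by_cases hψ : co ψ = 0
      · rw [hψ, zero_mul, zero_smul]; exact Submodule.zero_mem _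
      · exact Submodule.smul_mem _ _ (Submodule.subset_span ⟨ψ, hψ, rfl⟩)
    · rintro _ ⟨ψ₀, hψ₀, rfl⟩
      -- `Σ_g ψ₀(g⁻¹) tr g = |H| co(ψ₀) ψ₀`
      have hsum : ∑ g : H, cf ψ₀ g⁻¹ • tr g = ((Fintype.card H : ℂ) * co ψ₀) • cf ψ₀ := by
        simp_rw [htr, Finset.smul_sum, smul_smul]
        rw [Finset.sum_comm]
        have h1 : ∀ ψ : AddChar (Additive H) ℂ, ∑ g : H, (cf ψ₀ g⁻¹ * (co ψ * cf ψ g)) • cf ψ =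
            (co ψ * ∑ g : H, cf (ψ - ψ₀) g) • cf ψ := by
          intro ψ
          rw [← Finset.sum_smul, Finset.mul_sum]
          congr 1
          refine Finset.sum_congr rfl fun g _ => ?_
          simp only [cf, AddChar.sub_apply, ofMul_inv]
          ring
        simp_rw [h1]
        have h2 : ∀ ψ : AddChar (Additive H) ℂ, ∑ g : H, cf (ψ - ψ₀) g =
            if ψ - ψ₀ = 0 then (Fintype.card H : ℂ) else 0 := by
          intro ψ
          have h := AddChar.sum_eq_ite (ψ - ψ₀)
          have hc : Fintype.card (Additive H) = Fintype.card H := Fintype.card_congr Additive.toMul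
          rw [hc] at h
          rw [← h]
          exact Fintype.sum_equiv Additive.ofMul _ _ fun x => rfl
        simp_rw [h2, sub_eq_zero]
        rw [Finset.sum_eq_single ψ₀]
        · rw [if_pos rfl]; ring_nf
        · intro ψ _ hne; rw [if_neg hne, mul_zero, zero_smul]
        · intro h; exact absurd (Finset.mem_univ ψ₀) h
      have hc : (Fintype.card H : ℂ) * co ψ₀ ≠ 0 := mul_ne_zero hcard hψ₀
      have hmem : ((Fintype.card H : ℂ) * co ψ₀) • cf ψ₀ ∈ Submodule.span ℂ (Set.range tr) := by
        rw [← hsum]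
        exact Submodule.sum_mem _ fun g _ => Submodule.smul_mem _ _ (Submodule.subset_span ⟨g, rfl⟩)
      have := Submodule.smul_mem _ ((Fintype.card H : ℂ) * co ψ₀)⁻¹ hmem
      rwa [smul_smul, inv_mul_cancel₀ hc, one_smul] at this
  -- count: `rank = #C`
  have hrank : typeRank H (S : Set H) = C.ncard := by
    rw [typeRank_eq_finrank_translateSpan, translateSpan,
      ← finrank_span_range_ratCast_eq (E := H) (fun g : H => translateInd (S : Set H) g)]
    change Module.finrank ℂ (Submodule.span ℂ (Set.range tr)) = _
    rw [hspan]
    haveI : Fintype C := Fintype.ofFinite C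
    have hli' : LinearIndependent ℂ (fun ψ : C => cf (ψ : AddChar (Additive H) ℂ)) :=
      hli.comp _ Subtype.val_injective
    have hr : cf '' C = Set.range (fun ψ : C => cf (ψ : AddChar (Additive H) ℂ)) := by
      ext f; simp only [Set.mem_image, Set.mem_range, Subtype.exists, exists_prop]
    rw [hr, finrank_span_eq_card hli', Set.ncard_eq_toFinset_card', Set.toFinset_card]
  -- `C = −{ψ | Σ_{s∈S} ψ(s) ≠ 0}` under `ψ ↦ −ψ`
  have hCeq : C = (fun ψ => -ψ) '' {ψ : AddChar (Additive H) ℂ | ∑ s ∈ S, ψ (Additive.ofMul s) ≠ 0} := by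
    ext ψ
    simp only [hC, Set.mem_setOf_eq, Set.mem_image, co, cf]
    constructor
    · intro h
      refine ⟨-ψ, ?_, neg_neg ψ⟩
      intro h0
      apply h
      rw [show (∑ s ∈ S, ψ (Additive.ofMul s⁻¹)) = ∑ s ∈ S, (-ψ) (Additive.ofMul s) from
        Finset.sum_congr rfl fun s _ => by rw [AddChar.neg_apply, ofMul_inv], h0, mul_zero]
    · rintro ⟨ψ', hψ', rfl⟩
      refine mul_ne_zero (inv_ne_zero hcard) ?_
      rw [show (∑ s ∈ S, (-ψ') (Additive.ofMul s⁻¹)) = ∑ s ∈ S, ψ' (Additive.ofMul s) from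
        Finset.sum_congr rfl fun s _ => by rw [AddChar.neg_apply, ofMul_inv, neg_neg]]
      exact hψ'
  rw [hrank, hCeq, Set.ncard_image_of_injective _ neg_injective]

end FourierRank

end Literature.NumberTheory.ComplexMultiplication

end
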